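import Summits.QuantumFields.YangMills.Theorems.BalabanUVNodesN15CovariantLandauLetterRows
import Summits.QuantumFields.YangMills.Theorems.BalabanUVNodesN15BackwardShift
import Summits.QuantumFields.YangMills.Theorems.BalabanUVNodesN15TwoGridLocality
import HarnessLib

/-!
# Route «BalabanUVNodes», node N15 = NE2, road (c) — PROGRAMME (P-S), IV: THE COVARIANT PROPAGATOR ROWS FROM THE FLAT ONES BY NEUMANN SERIES, I — `G′(T)` has a sup-norm block row
# as soon as the FLAT kernels `G′(1)`, `∂G′(1)`, `G′(1)∂ᵀ` do, the covariant gradient difference `D_TG′(T) − ∂G′(1)` does, and the transporter letters `n·ρ`, `σ` are small; the local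
# rows of the one-difference factors `D_T − ∂`, `(D_T − ∂)ᵀ`, `Q′(T) − Q′(1)`, `Q′(T)` (dag-n15-c g23, n15-c∕215)

Cell `pub-ymgap`, seat `pub-ymgap-dag-n15-c` (generation g23; R134 (a), s1; HUMAN RULING D-0062; chair R424 venue).  `bears_on: R4∕N15 · K3⁸ SpineGivenEndpointR13SepCoPHV
(stmt-QuantumFields-27366)`; filed `--supports stmt-QuantumFields-27366 --as helper` — COUNT-NEUTRAL.  Theorems only; 0 `sorry`; NO estimate of Bałaban's (the flat rows and the gradient
difference are HYPOTHESES).  Imports BY NAME n15-c∕214 `…CovariantLandauLetterRows` (`hasMaj_csavg_transpose`, `hasMaj_csavg_sub_transpose`, `mulVecLin_neg'`; through it 212's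
`cGreen_fixedPoint`, `cGreen_sub_words`, `cSop_inv_fixedPoint`, 213's `hasMaj_mulVecLin_of_sum_abs_le`, `hasMaj_comp_localRight∕Left`, 205's `cgrad_sub_apply`, `cgrad_sub_rows_le`,
`cgrad_sub_cols_le`, `csavg_sub_apply`, `csavg_sub_rows_le`), dag-n15-a `…N15BackwardShift` (`tdistT_blockOf_sub_unitVec_le`), `…N15TwoGridLocality` (`hasMaj_smul_ofBlocks`),
n15-b (`exists_const_hasMaj_ofBlocks`, `kappa_ofBlocks`), `B11SectG.neumann_majorant`, `hasMaj_comp_exp`.  Nothing in the tree is modified.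

WHY.  n15-c∕214 `hasMaj_landauCov_sub` takes NINE primitive rows; four of them live at the background `T`: `G′(T)`, `G′(T) − G′(1)`, `(Q′G′²Q′ᵀ)⁻¹(T)` and `D_TG′(T) − ∂G′(1)`.
[Balaban1985BackgroundPropagators] Thm 3.4 p. 400: *«we prove quantitative statements … describing these analytic extensions as small perturbations of the operators depending on
U only»* — by the expansion (3.50)–(3.53) of `Δ_{U′U}` around `Δ_U` and a convergent series.  THIS FILE is that mechanism in the model, in the block-majorant calculus of
[Balaban1984PropagatorsII] (2.52)–(2.56) and the Neumann series [Balaban1985Variational] (188) (`B11SectG.neumann_majorant`): on n15-c∕212's fixed points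
`G′(T) = S₀ + K′·G′(T)`, `S(T)⁻¹ = S(1)⁻¹ − S(1)⁻¹(S(T) − S(1))·S(T)⁻¹` the small operators `K′` have rows `∝ n·ρ, σ` (the transporter letters of n15-c∕205: entry rows of `T − 1`,
staircase differences), so three of the four covariant rows FOLLOW from the flat rows (+ the a-priori boundedness automatic on a finite lattice) — this file: `G′(T)`; n15-c∕216: the other two.  The fourth, `D_TG′(T) − ∂G′(1)`, is a
Schauder-type statement (a gradient of a solution with a divergence-form source) that the sup-row calculus cannot bootstrap; it stays displayed (Thm 3.4).

RESULTS (`BS`∕`BV`∕`BC` as in n15-c∕214; `1` = the flat datum; rates lose the margin `s` of the row sum (2.61) per composition).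
* §1 local rows of the one-difference factors: `hasMaj_cgrad_sub` (`D_T − ∂ : BS → BV`, `nρ·e^{θ}e^{−θd}`, any `θ ≥ 0`: a bond reaches the neighbouring block), `hasMaj_cgrad_sub_transpose`
  (`(D_T − ∂)ᵀ`, `(d+1)nρ·e^{θ}e^{−θd}`), `hasMaj_csavg_sub` (`Q′(T) − Q′(1) : BS → BC`, `𝟙·σ`), `hasMaj_csavg` (`Q′(T)`, `𝟙·τ`), `mulVecLin_smul'`.
* §2 ★★ `hasMaj_cGreen_of_flat` — `G′(T) ≤ A(1 − θ_Kc)⁻¹e^{−(δ−2s)d}` from `G′(1)`, `G′(1)∂ᵀ`, `∂G′(1)`, `D_TG′(T) − ∂G′(1)` and `θ_Kc < 1`, `θ_K = C_A·nρe^{δ}c + |a|n^{−(d+1)}C_G(στ + σ)`.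
(The sequel n15-c∕216 does the same for `G′(T) − G′(1)` (n15-c∕212 `cGreen_sub_words`) and `(Q′G′²Q′ᵀ)⁻¹(T)` (`cSop_inv_fixedPoint`).)

HONEST FRAMING ∕ LIMITS.  Bookkeeping; the flat rows ([Balaban1984PropagatorsII] Props. 2.2–2.3 ∕ [B9] Thms 3.1–3.2 at `U ≡ 1`) and the gradient difference (Thm 3.4) are HYPOTHESES;
MODEL READING as n15-c∕197; NOT [Balaban1985BackgroundPropagators] Thms 3.1–3.4 as printed; NE2⁺ NOT PRINTED; N15 of record untouched (DISCHARGED AS CONSUMED, p687738); counts UNMOVED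
(typed 28∕28 · discharged 8∕27); one finite 𝕋⁴ at fixed ε per index — NOT infinite volume ∕ OS ∕ mass gap ∕ Clay.  Restate-immune (no Theses import).
-/

noncomputable section

open scoped BigOperators Matrix
open Finset

namespace Summit.QuantumFields.YangMills.BalabanUVNodes.N15.CovLandau

open Literature.MathematicalPhysics.QuantumFieldTheory.Balaban1983to89
open Literature.MathematicalPhysics.QuantumFieldTheory.Balaban1983to89.B5Prop11Plancherel (Tor fine unitVec)
open Literature.MathematicalPhysics.QuantumFieldTheory.Balaban1983to89.B11SectG (BlockNorm HasMaj RowSum hasMaj_comp_exp neumann_majorant)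
open Literature.MathematicalPhysics.QuantumFieldTheory.Balaban1983to89.B6UnitTorusCarrier (unitTorusGeo rowSum_unitTorusGeo triangle254_unitTorusGeo unitTorusGeo_dist_nonneg
  unitTorusGeo_dist_symm unitTorusGeo_dist_self card_fibre_blockOf)
open Literature.MathematicalPhysics.QuantumFieldTheory.Balaban1983to89.T4EtaRateCoeffDefect (fibre mem_fibre)
open Literature.MathematicalPhysics.QuantumFieldTheory.King1986.Torus (blockOf tdistT tdistT_nonneg tdistT_symm tdistT_self)
open Summit.QuantumFields.YangMills.BalabanUVNodes.N15.VectorPiece (blockCoords tdistT_blockOf_sub_unitVec_le)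
open Summit.QuantumFields.YangMills.BalabanUVNodes.N15.MatrixSpecies (liftBlk)
open Summit.QuantumFields.YangMills.BalabanUVNodes.N15.CovAvg (cvaStair cvaStair_one)
open Summit.QuantumFields.YangMills.BalabanUVNodes.N15.BackgroundModel (kappa_ofBlocks)
open Summit.QuantumFields.YangMills.BalabanUVNodes.N15.DerivDefect (exists_const_hasMaj_ofBlocks)
open Summit.QuantumFields.YangMills.BalabanUVNodes.N15.TwoGrid (hasMaj_smul_ofBlocks)
open Summit.QuantumFields.YangMills.BalabanUVNodes.N15.BlockRows (hasMaj_mulVecLin_of_sum_abs_le hasMaj_comp_localRight hasMaj_comp_localLeft)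

variable {d : ℕ} (M : Fin (d + 1) → ℕ) [∀ μ, NeZero (M μ)] (n : ℕ) [NeZero n] {ι : Type} [Fintype ι] [DecidableEq ι] (L k : ℕ)

/-! ## §1 The local rows of the one-difference factors -/

section Local

omit [∀ μ, NeZero (M μ)] [NeZero n] [DecidableEq ι] in
/-- `mulVecLin` of a scalar multiple. [folklore] -/
theorem mulVecLin_smul' {m p : Type} [Fintype p] (c : ℝ) (A : Matrix m p ℝ) : (c • A).mulVecLin = c • A.mulVecLin := by
  apply LinearMap.ext; intro v; simp

omit [∀ μ, NeZero (M μ)] [NeZero n] [DecidableEq ι] in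
/-- `mulVecLin` of a difference. [folklore] -/
theorem mulVecLin_sub' {m p : Type} [Fintype p] (A B : Matrix m p ℝ) : (A - B).mulVecLin = A.mulVecLin - B.mulVecLin := by
  apply LinearMap.ext; intro v; simp

/-- `|B(x + e_κ) − B(x)|_T ≤ 1` (from dag-n15-a's stepped-back version). [folklore] -/
theorem tdistT_blockOf_add_unitVec_le' (x : Tor (fine n M)) (κ : Fin (d + 1)) : tdistT M (blockOf n M x) (blockOf n M (x + unitVec (fine n M) κ)) ≤ 1 := by
  have h := tdistT_blockOf_sub_unitVec_le n M (x + unitVec (fine n M) κ) κ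
  rwa [add_sub_cancel_right] at h

omit [∀ μ, NeZero (M μ)] in
/-- An indicator of a pair of blocks at distance `≤ 1` under an exponential at any rate: `𝟙·m ≤ m·e^{θ}·e^{−θd}` when `d ≤ 1`, `m, θ ≥ 0`. [folklore] -/
theorem le_mul_exp_of_dist_le_one {m θ D : ℝ} (hm : 0 ≤ m) (hθ : 0 ≤ θ) (hD : D ≤ 1) : m ≤ m * Real.exp θ * Real.exp (-(θ * D)) := by
  have h : (1 : ℝ) ≤ Real.exp θ * Real.exp (-(θ * D)) := by
    rw [← Real.exp_add]
    exact Real.one_le_exp (by nlinarith)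
  calc m = m * 1 := (mul_one m).symm
    _ ≤ m * (Real.exp θ * Real.exp (-(θ * D))) := mul_le_mul_of_nonneg_left h hm
    _ = m * Real.exp θ * Real.exp (-(θ * D)) := by ring

/-- ★ `D_T − ∂ : BS → BV` has the row `nρ·e^{θ}·e^{−θd}` for every `θ ≥ 0` (`ρ` = entry-row letter of `T − 1`): the difference lives on the shift part, one bond reaches the same or the
neighbouring block. [cite: Balaban1985BackgroundPropagators, (3.50)–(3.52) p.400 (the first-order operator `V′₁(A)`: shape)] -/
theorem hasMaj_cgrad_sub (T : Fin (d + 1) → Tor (fine n M) → Matrix ι ι ℝ) {ρ θ : ℝ} (hρ0 : 0 ≤ ρ) (hθ : 0 ≤ θ)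
    (hρ : ∀ ν x i, ∑ j, |(T ν x - (fun (_ : Fin (d + 1)) (_ : Tor (fine n M)) => (1 : Matrix ι ι ℝ)) ν x) i j| ≤ ρ) :
    HasMaj (BlockNorm.ofBlocks (unitTorusGeo L k M) (liftBlk (blockOf n M) ι)) (BlockNorm.ofBlocks (unitTorusGeo L k M) (liftBlk (fun b : Tor (fine n M) × Fin (d + 1) => blockOf n M b.1) ι))
      (Matrix.mulVecLin (cgrad M n T - cgrad M n (fun (_ : Fin (d + 1)) (_ : Tor (fine n M)) => (1 : Matrix ι ι ℝ))))
      (fun y y' => (n : ℝ) * ρ * Real.exp θ * Real.exp (-(θ * tdistT M y y'))) := by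
  have hn : (0 : ℝ) ≤ n := Nat.cast_nonneg n
  refine hasMaj_mulVecLin_of_sum_abs_le _ _ (fun y y' => by positivity) fun p w' => ?_
  change ∑ q ∈ fibre (liftBlk (blockOf n M) ι) w', |(cgrad M n T - cgrad M n (fun (_ : Fin (d + 1)) (_ : Tor (fine n M)) => (1 : Matrix ι ι ℝ))) p q| ≤
    (n : ℝ) * ρ * Real.exp θ * Real.exp (-(θ * tdistT M (blockOf n M p.1.1) w'))
  by_cases hw : blockOf n M (p.1.1 + unitVec (fine n M) p.1.2) = w'
  · calc ∑ q ∈ fibre (liftBlk (blockOf n M) ι) w', |(cgrad M n T - cgrad M n (fun (_ : Fin (d + 1)) (_ : Tor (fine n M)) => (1 : Matrix ι ι ℝ))) p q|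
        ≤ ∑ q, |(cgrad M n T - cgrad M n (fun (_ : Fin (d + 1)) (_ : Tor (fine n M)) => (1 : Matrix ι ι ℝ))) p q| := Finset.sum_le_univ_sum_of_nonneg fun q => abs_nonneg _
      _ ≤ (n : ℝ) * ρ := cgrad_sub_rows_le M n (T := T) (T' := fun (_ : Fin (d + 1)) (_ : Tor (fine n M)) => (1 : Matrix ι ι ℝ)) hρ p
      _ ≤ (n : ℝ) * ρ * Real.exp θ * Real.exp (-(θ * tdistT M (blockOf n M p.1.1) w')) :=
          le_mul_exp_of_dist_le_one (mul_nonneg hn hρ0) hθ (by rw [← hw]; exact tdistT_blockOf_add_unitVec_le' M n p.1.1 p.1.2)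
  · refine le_trans (le_of_eq (Finset.sum_eq_zero fun q hq => ?_)) (by positivity)
    have hq1 : blockOf n M q.1 = w' := (mem_fibre (liftBlk (blockOf n M) ι) w' q).1 hq
    rw [cgrad_sub_apply]
    have : ¬ q.1 = p.1.1 + unitVec (fine n M) p.1.2 := fun h => hw (by rw [← h]; exact hq1)
    simp [this]

/-- ★ `(D_T − ∂)ᵀ : BV → BS` has the row `(d+1)nρ·e^{θ}·e^{−θd}` (`ρ` = entry-COLUMN letter of `T − 1`; each site is the far end of one bond per direction).
[cite: Balaban1985BackgroundPropagators, (3.50)–(3.52) p.400 (shape)] -/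
theorem hasMaj_cgrad_sub_transpose (T : Fin (d + 1) → Tor (fine n M) → Matrix ι ι ℝ) {ρ θ : ℝ} (hρ0 : 0 ≤ ρ) (hθ : 0 ≤ θ)
    (hρ : ∀ ν x j, ∑ i, |(T ν x - (fun (_ : Fin (d + 1)) (_ : Tor (fine n M)) => (1 : Matrix ι ι ℝ)) ν x) i j| ≤ ρ) :
    HasMaj (BlockNorm.ofBlocks (unitTorusGeo L k M) (liftBlk (fun b : Tor (fine n M) × Fin (d + 1) => blockOf n M b.1) ι)) (BlockNorm.ofBlocks (unitTorusGeo L k M) (liftBlk (blockOf n M) ι))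
      (Matrix.mulVecLin (cgrad M n T - cgrad M n (fun (_ : Fin (d + 1)) (_ : Tor (fine n M)) => (1 : Matrix ι ι ℝ)))ᵀ)
      (fun y y' => (n : ℝ) * ((d + 1 : ℕ) * ρ) * Real.exp θ * Real.exp (-(θ * tdistT M y y'))) := by
  have hn : (0 : ℝ) ≤ n := Nat.cast_nonneg n
  refine hasMaj_mulVecLin_of_sum_abs_le _ _ (fun y y' => by positivity) fun q w' => ?_
  change ∑ p ∈ fibre (liftBlk (fun b : Tor (fine n M) × Fin (d + 1) => blockOf n M b.1) ι) w', |(cgrad M n T - cgrad M n (fun (_ : Fin (d + 1)) (_ : Tor (fine n M)) => (1 : Matrix ι ι ℝ)))ᵀ q p| ≤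
    (n : ℝ) * ((d + 1 : ℕ) * ρ) * Real.exp θ * Real.exp (-(θ * tdistT M (blockOf n M q.1) w'))
  simp only [Matrix.transpose_apply]
  by_cases hw : tdistT M (blockOf n M q.1) w' ≤ 1
  · calc ∑ p ∈ fibre (liftBlk (fun b : Tor (fine n M) × Fin (d + 1) => blockOf n M b.1) ι) w', |(cgrad M n T - cgrad M n (fun (_ : Fin (d + 1)) (_ : Tor (fine n M)) => (1 : Matrix ι ι ℝ))) p q|
        ≤ ∑ p, |(cgrad M n T - cgrad M n (fun (_ : Fin (d + 1)) (_ : Tor (fine n M)) => (1 : Matrix ι ι ℝ))) p q| := Finset.sum_le_univ_sum_of_nonneg fun p => abs_nonneg _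
      _ ≤ (n : ℝ) * (Fintype.card (Fin (d + 1)) * ρ) := cgrad_sub_cols_le M n (T := T) (T' := fun (_ : Fin (d + 1)) (_ : Tor (fine n M)) => (1 : Matrix ι ι ℝ)) hρ q
      _ = (n : ℝ) * ((d + 1 : ℕ) * ρ) := by rw [Fintype.card_fin]
      _ ≤ (n : ℝ) * ((d + 1 : ℕ) * ρ) * Real.exp θ * Real.exp (-(θ * tdistT M (blockOf n M q.1) w')) := le_mul_exp_of_dist_le_one (by positivity) hθ hw
  · refine le_trans (le_of_eq (Finset.sum_eq_zero fun p hp => ?_)) (by positivity)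
    have hp1 : blockOf n M p.1.1 = w' := (mem_fibre (liftBlk (fun b : Tor (fine n M) × Fin (d + 1) => blockOf n M b.1) ι) w' p).1 hp
    rw [cgrad_sub_apply]
    have : ¬ q.1 = p.1.1 + unitVec (fine n M) p.1.2 := by
      intro h
      apply hw
      rw [h, ← hp1, tdistT_symm]
      exact tdistT_blockOf_add_unitVec_le' M n p.1.1 p.1.2
    simp [this]

/-- ★ `Q′(T) − Q′(1) : BS → BC` has the block-diagonal row `𝟙[y = y′]·σ` (`σ` = ROW letter of the staircase-transport difference; `n^{d+1}` points against the weight `n^{−(d+1)}`).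
[cite: Balaban1985BackgroundPropagators, Thm 3.4 p.400 (mechanism)] -/
theorem hasMaj_csavg_sub (T : Fin (d + 1) → Tor (fine n M) → Matrix ι ι ℝ) {σ : ℝ} (hσ0 : 0 ≤ σ)
    (hσ : ∀ y a i, ∑ j, |(cvaStair M n (fun μ b => T μ b.1) y a 0 - cvaStair M n (fun μ b => (fun (_ : Fin (d + 1)) (_ : Tor (fine n M)) => (1 : Matrix ι ι ℝ)) μ b.1) y a 0) i j| ≤ σ) :
    HasMaj (BlockNorm.ofBlocks (unitTorusGeo L k M) (liftBlk (blockOf n M) ι)) (BlockNorm.ofBlocks (unitTorusGeo L k M) (liftBlk (fun y : Tor M => y) ι))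
      (Matrix.mulVecLin (csavg M n T - csavg M n (fun (_ : Fin (d + 1)) (_ : Tor (fine n M)) => (1 : Matrix ι ι ℝ))))
      (fun w w' => if w = w' then σ else 0) := by
  refine hasMaj_mulVecLin_of_sum_abs_le _ _ (fun w w' => by split_ifs <;> positivity) fun q w' => ?_
  change ∑ p ∈ fibre (liftBlk (blockOf n M) ι) w', |(csavg M n T - csavg M n (fun (_ : Fin (d + 1)) (_ : Tor (fine n M)) => (1 : Matrix ι ι ℝ))) q p| ≤ if q.1 = w' then σ else 0
  split_ifs with hw
  · calc ∑ p ∈ fibre (liftBlk (blockOf n M) ι) w', |(csavg M n T - csavg M n (fun (_ : Fin (d + 1)) (_ : Tor (fine n M)) => (1 : Matrix ι ι ℝ))) q p|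
        ≤ ∑ p, |(csavg M n T - csavg M n (fun (_ : Fin (d + 1)) (_ : Tor (fine n M)) => (1 : Matrix ι ι ℝ))) q p| := Finset.sum_le_univ_sum_of_nonneg fun p => abs_nonneg _
      _ ≤ σ := csavg_sub_rows_le M n (T := T) (T' := fun (_ : Fin (d + 1)) (_ : Tor (fine n M)) => (1 : Matrix ι ι ℝ)) hσ q
  · refine le_of_eq (Finset.sum_eq_zero fun p hp => ?_)
    have hp1 : blockOf n M p.1 = w' := (mem_fibre (liftBlk (blockOf n M) ι) w' p).1 hp
    rw [csavg_sub_apply]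
    have : ¬ blockOf n M p.1 = q.1 := fun h => hw (h.symm.trans hp1)
    simp [this]

/-- ★ `Q′(T) : BS → BC` has the block-diagonal row `𝟙[y = y′]·τ` (`τ` = row letter of the staircase transports). [cite: Balaban1985BackgroundPropagators, (3.19) p.393 (shape)] -/
theorem hasMaj_csavg (T : Fin (d + 1) → Tor (fine n M) → Matrix ι ι ℝ) {τ : ℝ} (hτ0 : 0 ≤ τ) (hτ : ∀ y a i, ∑ j, |cvaStair M n (fun μ b => T μ b.1) y a 0 i j| ≤ τ) :
    HasMaj (BlockNorm.ofBlocks (unitTorusGeo L k M) (liftBlk (blockOf n M) ι)) (BlockNorm.ofBlocks (unitTorusGeo L k M) (liftBlk (fun y : Tor M => y) ι))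
      (Matrix.mulVecLin (csavg M n T)) (fun w w' => if w = w' then τ else 0) := by
  have hn : (0 : ℝ) < (n : ℝ) ^ (d + 1) := pow_pos (Nat.cast_pos.mpr (Nat.pos_of_ne_zero (NeZero.ne n))) _
  refine hasMaj_mulVecLin_of_sum_abs_le _ _ (fun w w' => by split_ifs <;> positivity) fun q w' => ?_
  change ∑ p ∈ fibre (liftBlk (blockOf n M) ι) w', |csavg M n T q p| ≤ if q.1 = w' then τ else 0
  split_ifs with hw
  · -- the block sum over the coloured points of `B(q.1)`: each fine site contributes `n^{−(d+1)}·Σ_i |T(Γ)_{q.2 i}| ≤ n^{−(d+1)}τ`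
    calc ∑ p ∈ fibre (liftBlk (blockOf n M) ι) w', |csavg M n T q p|
        ≤ ∑ p, |csavg M n T q p| := Finset.sum_le_univ_sum_of_nonneg fun p => abs_nonneg _
      _ = ∑ x, ∑ i, |csavg M n T q (x, i)| := Fintype.sum_prod_type _
      _ ≤ ∑ x : Tor (fine n M), (if blockOf n M x = q.1 then ((n : ℝ) ^ (d + 1))⁻¹ * τ else 0) := Finset.sum_le_sum fun x _ => by
          simp only [csavg]
          split_ifs with hx
          · calc ∑ i, |((n : ℝ) ^ (d + 1))⁻¹ * cvaStair M n (fun μ b => T μ b.1) q.1 (blockCoords n M x).2 0 q.2 i|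
                = ((n : ℝ) ^ (d + 1))⁻¹ * ∑ i, |cvaStair M n (fun μ b => T μ b.1) q.1 (blockCoords n M x).2 0 q.2 i| := by
                  rw [Finset.mul_sum]; exact Finset.sum_congr rfl fun i _ => by rw [abs_mul, abs_inv, abs_pow, Nat.abs_cast]
              _ ≤ ((n : ℝ) ^ (d + 1))⁻¹ * τ := mul_le_mul_of_nonneg_left (hτ _ _ _) (inv_nonneg.mpr hn.le)
          · simp
      _ = ∑ x ∈ fibre (blockOf n M) q.1, ((n : ℝ) ^ (d + 1))⁻¹ * τ := by rw [fibre, Finset.sum_filter]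
      _ = τ := by
          rw [Finset.sum_const, card_fibre_blockOf, nsmul_eq_mul]
          push_cast
          rw [mul_inv_cancel_left₀ hn.ne']
  · refine le_of_eq (Finset.sum_eq_zero fun p hp => ?_)
    have hp1 : blockOf n M p.1 = w' := (mem_fibre (liftBlk (blockOf n M) ι) w' p).1 hp
    have : ¬ blockOf n M p.1 = q.1 := fun h => hw (h.symm.trans hp1)
    simp [csavg, this]

omit [∀ μ, NeZero (M μ)] in
/-- The flat staircase transports have column sums `1`. [folklore] -/
theorem stair_one_cols (y : Tor M) (a' : Fin (d + 1) → Fin n) (i : ι) :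
    ∑ j, |cvaStair M n (fun μ b => (fun (_ : Fin (d + 1)) (_ : Tor (fine n M)) => (1 : Matrix ι ι ℝ)) μ b.1) y a' 0 j i| ≤ 1 := by
  have h : cvaStair M n (fun (μ : Fin (d + 1)) (b : Tor (fine n M) × Fin (d + 1)) => (1 : Matrix ι ι ℝ)) y a' 0 = 1 := cvaStair_one M n y a' 0
  have h1 : ∀ j : ι, |(1 : Matrix ι ι ℝ) j i| = if j = i then 1 else 0 := fun j => by
    by_cases hj : j = i
    · subst hj; simp
    · simp [hj]
  change ∑ j, |(cvaStair M n (fun (μ : Fin (d + 1)) (b : Tor (fine n M) × Fin (d + 1)) => (1 : Matrix ι ι ℝ)) y a' 0) j i| ≤ 1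
  rw [h]
  simp only [h1, Finset.sum_ite_eq', Finset.mem_univ, if_true, le_refl]

end Local

/-! ## §2 `G′(T)` from the flat rows by the Neumann series over n15-c∕212's fixed point -/

section Green

/-- ★★ **THE ROW OF `G′(T)` FROM THE FLAT ROWS.**  With the flat rows `G′(1) ≤ C_Ge^{−δd}` ((BlockNorm.ofBlocks (unitTorusGeo L k M) (liftBlk (blockOf n M) ι)) → (BlockNorm.ofBlocks (unitTorusGeo L k M) (liftBlk (blockOf n M) ι))), `G′(1)∂ᵀ ≤ C_Ae^{−δd}` ((BlockNorm.ofBlocks (unitTorusGeo L k M) (liftBlk (fun b : Tor (fine n M) × Fin (d + 1) => blockOf n M b.1) ι)) → (BlockNorm.ofBlocks (unitTorusGeo L k M) (liftBlk (blockOf n M) ι))), `∂G′(1) ≤ C_De^{−δd}` ((BlockNorm.ofBlocks (unitTorusGeo L k M) (liftBlk (blockOf n M) ι)) → (BlockNorm.ofBlocks (unitTorusGeo L k M) (liftBlk (fun b : Tor (fine n M) × Fin (d + 1) => blockOf n M b.1) ι))), the covariant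
gradient difference `D_TG′(T) − ∂G′(1) ≤ P_De^{−δd}`, the transporter letters `ρ` (entry rows AND columns of `T − 1`), `σ` (staircase differences, rows and columns), `τ` (staircase rows),
the margin `0 < s ≤ δ/2` with row-sum constant `c`, and the smallness `θ_K·c < 1`, `θ_K = C_A·nρe^{δ}·c + |a|·n^{−(d+1)}·C_G·(στ + σ)`: the fixed point `G′(T) = S₀ + K′G′(T)` of n15-c∕212
gives `G′(T) ≤ A·(1 − θ_Kc)⁻¹·e^{−(δ−2s)d}` with `A = C_G + C_G·(d+1)nρ·e^{δ}·(C_D + P_D)·c²`.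
[cite: Balaban1985BackgroundPropagators, Thm 3.4 p.400, (3.50)–(3.53) p.400 (mechanism); Balaban1985Variational, (188) p.308; Balaban1984PropagatorsII, (2.52)–(2.56) pp.232–233] -/
theorem hasMaj_cGreen_of_flat {T : Fin (d + 1) → Tor (fine n M) → Matrix ι ι ℝ} (hT : ∀ ν x, IsUnit (T ν x)) {a : ℝ} (ha : 0 < a)
    {δ s c CG CA CD PD ρ σ τ : ℝ} (hs : 0 < s) (hsδ : 2 * s ≤ δ) (hrow : RowSum (unitTorusGeo L k M) s c) (hc : 0 ≤ c)
    (hCG : 0 ≤ CG) (hCA : 0 ≤ CA) (hCD : 0 ≤ CD) (hPD : 0 ≤ PD) (hρ0 : 0 ≤ ρ) (hσ0 : 0 ≤ σ) (hτ0 : 0 ≤ τ)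
    (hρr : ∀ ν x i, ∑ j, |(T ν x - (fun (_ : Fin (d + 1)) (_ : Tor (fine n M)) => (1 : Matrix ι ι ℝ)) ν x) i j| ≤ ρ)
    (hρc : ∀ ν x j, ∑ i, |(T ν x - (fun (_ : Fin (d + 1)) (_ : Tor (fine n M)) => (1 : Matrix ι ι ℝ)) ν x) i j| ≤ ρ)
    (hσr : ∀ y a' i, ∑ j, |(cvaStair M n (fun μ b => T μ b.1) y a' 0 - cvaStair M n (fun μ b => (fun (_ : Fin (d + 1)) (_ : Tor (fine n M)) => (1 : Matrix ι ι ℝ)) μ b.1) y a' 0) i j| ≤ σ)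
    (hσc : ∀ y a' j, ∑ i, |(cvaStair M n (fun μ b => T μ b.1) y a' 0 - cvaStair M n (fun μ b => (fun (_ : Fin (d + 1)) (_ : Tor (fine n M)) => (1 : Matrix ι ι ℝ)) μ b.1) y a' 0) i j| ≤ σ)
    (hτr : ∀ y a' i, ∑ j, |cvaStair M n (fun μ b => T μ b.1) y a' 0 i j| ≤ τ)
    (hG1 : HasMaj (BlockNorm.ofBlocks (unitTorusGeo L k M) (liftBlk (blockOf n M) ι)) (BlockNorm.ofBlocks (unitTorusGeo L k M) (liftBlk (blockOf n M) ι))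
      (Matrix.mulVecLin (cGreen M n (fun (_ : Fin (d + 1)) (_ : Tor (fine n M)) => (1 : Matrix ι ι ℝ)) a)) (fun y y' => CG * Real.exp (-(δ * tdistT M y y'))))
    (hA1 : HasMaj (BlockNorm.ofBlocks (unitTorusGeo L k M) (liftBlk (fun b : Tor (fine n M) × Fin (d + 1) => blockOf n M b.1) ι)) (BlockNorm.ofBlocks (unitTorusGeo L k M) (liftBlk (blockOf n M) ι))
      (Matrix.mulVecLin (cGreen M n (fun (_ : Fin (d + 1)) (_ : Tor (fine n M)) => (1 : Matrix ι ι ℝ)) a * (cgrad M n (fun (_ : Fin (d + 1)) (_ : Tor (fine n M)) => (1 : Matrix ι ι ℝ)))ᵀ))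
      (fun y y' => CA * Real.exp (-(δ * tdistT M y y'))))
    (hD1 : HasMaj (BlockNorm.ofBlocks (unitTorusGeo L k M) (liftBlk (blockOf n M) ι)) (BlockNorm.ofBlocks (unitTorusGeo L k M) (liftBlk (fun b : Tor (fine n M) × Fin (d + 1) => blockOf n M b.1) ι))
      (Matrix.mulVecLin (cgrad M n (fun (_ : Fin (d + 1)) (_ : Tor (fine n M)) => (1 : Matrix ι ι ℝ)) * cGreen M n (fun (_ : Fin (d + 1)) (_ : Tor (fine n M)) => (1 : Matrix ι ι ℝ)) a))
      (fun y y' => CD * Real.exp (-(δ * tdistT M y y'))))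
    (hδD : HasMaj (BlockNorm.ofBlocks (unitTorusGeo L k M) (liftBlk (blockOf n M) ι)) (BlockNorm.ofBlocks (unitTorusGeo L k M) (liftBlk (fun b : Tor (fine n M) × Fin (d + 1) => blockOf n M b.1) ι))
      (Matrix.mulVecLin (cgrad M n T * cGreen M n T a - cgrad M n (fun (_ : Fin (d + 1)) (_ : Tor (fine n M)) => (1 : Matrix ι ι ℝ)) * cGreen M n (fun (_ : Fin (d + 1)) (_ : Tor (fine n M)) => (1 : Matrix ι ι ℝ)) a))
      (fun y y' => PD * Real.exp (-(δ * tdistT M y y'))))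
    (hq : (CA * ((n : ℝ) * ρ * Real.exp δ) * c + |a| * (((n : ℝ) ^ (d + 1))⁻¹ * CG * (σ * τ + σ))) * c < 1) :
    HasMaj (BlockNorm.ofBlocks (unitTorusGeo L k M) (liftBlk (blockOf n M) ι)) (BlockNorm.ofBlocks (unitTorusGeo L k M) (liftBlk (blockOf n M) ι))
      (Matrix.mulVecLin (cGreen M n T a))
      (fun y y' => (CG + CG * ((n : ℝ) * ((d + 1 : ℕ) * ρ) * Real.exp δ) * (CD + PD) * c * c) *
        (1 - (CA * ((n : ℝ) * ρ * Real.exp δ) * c + |a| * (((n : ℝ) ^ (d + 1))⁻¹ * CG * (σ * τ + σ))) * c)⁻¹ * Real.exp (-((δ - 2 * s) * tdistT M y y'))) := by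
  have hn : (0 : ℝ) < (n : ℝ) ^ (d + 1) := pow_pos (Nat.cast_pos.mpr (Nat.pos_of_ne_zero (NeZero.ne n))) _
  have hδ : 0 ≤ δ := by linarith
  have htri := triangle254_unitTorusGeo L k M
  have hd := unitTorusGeo_dist_nonneg L k M
  have h1unit : ∀ (ν : Fin (d + 1)) (x : Tor (fine n M)), IsUnit ((fun (_ : Fin (d + 1)) (_ : Tor (fine n M)) => (1 : Matrix ι ι ℝ)) ν x) := fun _ _ => isUnit_one
  have hκS : (BlockNorm.ofBlocks (unitTorusGeo L k M) (liftBlk (blockOf n M) ι)).κ = 1 := kappa_ofBlocks _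
  have hκV : (BlockNorm.ofBlocks (unitTorusGeo L k M) (liftBlk (fun b : Tor (fine n M) × Fin (d + 1) => blockOf n M b.1) ι)).κ = 1 := kappa_ofBlocks _
  have hκC : (BlockNorm.ofBlocks (unitTorusGeo L k M) (liftBlk (fun y : Tor M => y) ι)).κ = 1 := kappa_ofBlocks _
  -- the local rows
  have hDD := hasMaj_cgrad_sub M n L k T hρ0 hδ hρr
  have hDDt := hasMaj_cgrad_sub_transpose M n L k T hρ0 hδ hρc
  have hQQ := hasMaj_csavg_sub M n L k T hσ0 hσr
  have hQQt := hasMaj_csavg_sub_transpose M n L k T hσ0 hσc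
  have hQ := hasMaj_csavg M n L k T hτ0 hτr
  have hQ1t := hasMaj_csavg_transpose M n L k (fun (_ : Fin (d + 1)) (_ : Tor (fine n M)) => (1 : Matrix ι ι ℝ)) zero_le_one (stair_one_cols M n)
  -- the gradient row at `T`
  have hDT : HasMaj (BlockNorm.ofBlocks (unitTorusGeo L k M) (liftBlk (blockOf n M) ι)) (BlockNorm.ofBlocks (unitTorusGeo L k M) (liftBlk (fun b : Tor (fine n M) × Fin (d + 1) => blockOf n M b.1) ι)) (Matrix.mulVecLin (cgrad M n T * cGreen M n T a)) (fun y y' => (CD + PD) * Real.exp (-(δ * tdistT M y y'))) := by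
    rw [cgrad_mul_cGreen_eq_add M n T (fun (_ : Fin (d + 1)) (_ : Tor (fine n M)) => (1 : Matrix ι ι ℝ)) a, Matrix.mulVecLin_add]
    exact (hD1.add hδD).mono fun y y' => le_of_eq (by ring)
  -- the small operator `K′`: three words
  have hk1 : HasMaj (BlockNorm.ofBlocks (unitTorusGeo L k M) (liftBlk (blockOf n M) ι)) (BlockNorm.ofBlocks (unitTorusGeo L k M) (liftBlk (blockOf n M) ι)) (Matrix.mulVecLin (cGreen M n (fun _ _ => (1 : Matrix ι ι ℝ)) a * (cgrad M n (fun _ _ => (1 : Matrix ι ι ℝ)))ᵀ * (cgrad M n T - cgrad M n fun _ _ => 1)))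
      (fun y y' => (BlockNorm.ofBlocks (unitTorusGeo L k M) (liftBlk (blockOf n M) ι)).κ * CA * ((n : ℝ) * ρ * Real.exp δ) * c * Real.exp (-((δ - s) * tdistT M y y'))) := by
    rw [Matrix.mulVecLin_mul]
    exact hasMaj_comp_exp (ρ := δ - s) htri hd hrow hCA (by positivity) (by linarith) (by linarith) (by linarith) hA1 hDD
  have hk2 : HasMaj (BlockNorm.ofBlocks (unitTorusGeo L k M) (liftBlk (blockOf n M) ι)) (BlockNorm.ofBlocks (unitTorusGeo L k M) (liftBlk (blockOf n M) ι)) (Matrix.mulVecLin (cGreen M n (fun _ _ => (1 : Matrix ι ι ℝ)) a * (csavg M n T - csavg M n fun _ _ => 1)ᵀ * csavg M n T))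
      (fun y y' => CG * Real.exp (-(δ * tdistT M y y')) * ((BlockNorm.ofBlocks (unitTorusGeo L k M) (liftBlk (blockOf n M) ι)).κ * (((n : ℝ) ^ (d + 1))⁻¹ * σ * ((BlockNorm.ofBlocks (unitTorusGeo L k M) (liftBlk (fun y : Tor M => y) ι)).κ * τ)))) := by
    rw [Matrix.mulVecLin_mul, Matrix.mulVecLin_mul]
    have hinner := hasMaj_comp_localRight hQQt hQ fun y y' => by positivity
    have hinner' : HasMaj (BlockNorm.ofBlocks (unitTorusGeo L k M) (liftBlk (blockOf n M) ι)) (BlockNorm.ofBlocks (unitTorusGeo L k M) (liftBlk (blockOf n M) ι)) (Matrix.mulVecLin (csavg M n T - csavg M n fun _ _ => 1)ᵀ ∘ₗ Matrix.mulVecLin (csavg M n T))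
        (fun y y' => if y = y' then ((n : ℝ) ^ (d + 1))⁻¹ * σ * ((BlockNorm.ofBlocks (unitTorusGeo L k M) (liftBlk (fun y : Tor M => y) ι)).κ * τ) else 0) :=
      hinner.mono fun y y' => by split_ifs <;> simp
    rw [LinearMap.comp_assoc]
    exact hasMaj_comp_localRight hG1 hinner' fun y y' => by positivity
  have hk3 : HasMaj (BlockNorm.ofBlocks (unitTorusGeo L k M) (liftBlk (blockOf n M) ι)) (BlockNorm.ofBlocks (unitTorusGeo L k M) (liftBlk (blockOf n M) ι)) (Matrix.mulVecLin (cGreen M n (fun _ _ => (1 : Matrix ι ι ℝ)) a * (csavg M n fun _ _ => (1 : Matrix ι ι ℝ))ᵀ * (csavg M n T - csavg M n fun _ _ => 1)))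
      (fun y y' => CG * Real.exp (-(δ * tdistT M y y')) * ((BlockNorm.ofBlocks (unitTorusGeo L k M) (liftBlk (blockOf n M) ι)).κ * (((n : ℝ) ^ (d + 1))⁻¹ * 1 * ((BlockNorm.ofBlocks (unitTorusGeo L k M) (liftBlk (fun y : Tor M => y) ι)).κ * σ)))) := by
    rw [Matrix.mulVecLin_mul, Matrix.mulVecLin_mul]
    have hinner := hasMaj_comp_localRight hQ1t hQQ fun y y' => by positivity
    have hinner' : HasMaj (BlockNorm.ofBlocks (unitTorusGeo L k M) (liftBlk (blockOf n M) ι)) (BlockNorm.ofBlocks (unitTorusGeo L k M) (liftBlk (blockOf n M) ι)) (Matrix.mulVecLin (csavg M n fun _ _ => (1 : Matrix ι ι ℝ))ᵀ ∘ₗ Matrix.mulVecLin (csavg M n T - csavg M n fun _ _ => 1))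
        (fun y y' => if y = y' then ((n : ℝ) ^ (d + 1))⁻¹ * 1 * ((BlockNorm.ofBlocks (unitTorusGeo L k M) (liftBlk (fun y : Tor M => y) ι)).κ * σ) else 0) :=
      hinner.mono fun y y' => by split_ifs <;> simp
    rw [LinearMap.comp_assoc]
    exact hasMaj_comp_localRight hG1 hinner' fun y y' => by positivity
  -- canonical shapes `const · e^{−rate·d}`
  have hk1' : HasMaj (BlockNorm.ofBlocks (unitTorusGeo L k M) (liftBlk (blockOf n M) ι)) (BlockNorm.ofBlocks (unitTorusGeo L k M) (liftBlk (blockOf n M) ι)) (Matrix.mulVecLin (cGreen M n (fun _ _ => (1 : Matrix ι ι ℝ)) a * (cgrad M n (fun _ _ => (1 : Matrix ι ι ℝ)))ᵀ * (cgrad M n T - cgrad M n fun _ _ => 1)))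
      (fun y y' => (CA * ((n : ℝ) * ρ * Real.exp δ) * c) * Real.exp (-((δ - s) * tdistT M y y'))) :=
    hk1.mono fun y y' => le_of_eq (by rw [hκS]; ring)
  have hk2' : HasMaj (BlockNorm.ofBlocks (unitTorusGeo L k M) (liftBlk (blockOf n M) ι)) (BlockNorm.ofBlocks (unitTorusGeo L k M) (liftBlk (blockOf n M) ι)) (Matrix.mulVecLin (cGreen M n (fun _ _ => (1 : Matrix ι ι ℝ)) a * (csavg M n T - csavg M n fun _ _ => 1)ᵀ * csavg M n T))
      (fun y y' => (CG * (((n : ℝ) ^ (d + 1))⁻¹ * σ * τ)) * Real.exp (-((δ - s) * tdistT M y y'))) := by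
    refine (hk2.mono fun y y' => le_of_eq (by rw [hκS, hκC]; ring)).of_rate_le hd (by positivity) (by linarith : δ - s ≤ δ)
  have hk3' : HasMaj (BlockNorm.ofBlocks (unitTorusGeo L k M) (liftBlk (blockOf n M) ι)) (BlockNorm.ofBlocks (unitTorusGeo L k M) (liftBlk (blockOf n M) ι)) (Matrix.mulVecLin (cGreen M n (fun _ _ => (1 : Matrix ι ι ℝ)) a * (csavg M n fun _ _ => (1 : Matrix ι ι ℝ))ᵀ * (csavg M n T - csavg M n fun _ _ => 1)))
      (fun y y' => (CG * (((n : ℝ) ^ (d + 1))⁻¹ * σ)) * Real.exp (-((δ - s) * tdistT M y y'))) := by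
    refine (hk3.mono fun y y' => le_of_eq (by rw [hκS, hκC]; ring)).of_rate_le hd (by positivity) (by linarith : δ - s ≤ δ)
  -- `K′` itself
  set θK : ℝ := CA * ((n : ℝ) * ρ * Real.exp δ) * c + |a| * (((n : ℝ) ^ (d + 1))⁻¹ * CG * (σ * τ + σ)) with hθK
  have hθK0 : 0 ≤ θK := by positivity
  have hKmat : -(cGreen M n (fun _ _ => (1 : Matrix ι ι ℝ)) a * ((cgrad M n fun _ _ => (1 : Matrix ι ι ℝ))ᵀ * (cgrad M n T - cgrad M n fun _ _ => 1) +
      a • ((csavg M n T - csavg M n fun _ _ => 1)ᵀ * csavg M n T) + a • ((csavg M n fun _ _ => (1 : Matrix ι ι ℝ))ᵀ * (csavg M n T - csavg M n fun _ _ => 1)))) =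
      -(cGreen M n (fun _ _ => (1 : Matrix ι ι ℝ)) a * (cgrad M n (fun _ _ => (1 : Matrix ι ι ℝ)))ᵀ * (cgrad M n T - cgrad M n fun _ _ => 1))
        - a • (cGreen M n (fun _ _ => (1 : Matrix ι ι ℝ)) a * (csavg M n T - csavg M n fun _ _ => 1)ᵀ * csavg M n T)
        - a • (cGreen M n (fun _ _ => (1 : Matrix ι ι ℝ)) a * (csavg M n fun _ _ => (1 : Matrix ι ι ℝ))ᵀ * (csavg M n T - csavg M n fun _ _ => 1)) := by
    simp only [Matrix.mul_add, Matrix.mul_smul, Matrix.mul_assoc, neg_add]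
    abel
  have hK : HasMaj (BlockNorm.ofBlocks (unitTorusGeo L k M) (liftBlk (blockOf n M) ι)) (BlockNorm.ofBlocks (unitTorusGeo L k M) (liftBlk (blockOf n M) ι)) (Matrix.mulVecLin (-(cGreen M n (fun _ _ => (1 : Matrix ι ι ℝ)) a * ((cgrad M n fun _ _ => (1 : Matrix ι ι ℝ))ᵀ * (cgrad M n T - cgrad M n fun _ _ => 1) +
      a • ((csavg M n T - csavg M n fun _ _ => 1)ᵀ * csavg M n T) + a • ((csavg M n fun _ _ => (1 : Matrix ι ι ℝ))ᵀ * (csavg M n T - csavg M n fun _ _ => 1))))))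
      (fun y y' => θK * Real.exp (-((δ - s) * tdistT M y y'))) := by
    rw [hKmat, mulVecLin_sub', mulVecLin_sub', mulVecLin_neg', mulVecLin_smul', mulVecLin_smul']
    have h2 := hasMaj_smul_ofBlocks (g := unitTorusGeo L k M) (liftBlk (blockOf n M) ι) (K := fun y y' => (CG * (((n : ℝ) ^ (d + 1))⁻¹ * σ * τ)) * Real.exp (-((δ - s) * tdistT M y y')))
      (fun y y' => by positivity) a hk2'
    have h3 := hasMaj_smul_ofBlocks (g := unitTorusGeo L k M) (liftBlk (blockOf n M) ι) (K := fun y y' => (CG * (((n : ℝ) ^ (d + 1))⁻¹ * σ)) * Real.exp (-((δ - s) * tdistT M y y')))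
      (fun y y' => by positivity) a hk3'
    refine ((hk1'.neg.sub h2).sub h3).mono fun y y' => le_of_eq ?_
    rw [hθK]
    ring
  -- the source `S₀ = G′(1) − G′(1)(D_T − ∂)ᵀ·(D_TG′(T))`
  have hin := hasMaj_comp_exp (ρ := δ - s) htri hd hrow hCG (by positivity) (by linarith) (by linarith) (by linarith) hG1 hDDt
  have hterm2 : HasMaj (BlockNorm.ofBlocks (unitTorusGeo L k M) (liftBlk (blockOf n M) ι)) (BlockNorm.ofBlocks (unitTorusGeo L k M) (liftBlk (blockOf n M) ι)) (Matrix.mulVecLin (cGreen M n (fun _ _ => (1 : Matrix ι ι ℝ)) a * (cgrad M n T - cgrad M n fun _ _ => 1)ᵀ * (cgrad M n T * cGreen M n T a)))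
      (fun y y' => (BlockNorm.ofBlocks (unitTorusGeo L k M) (liftBlk (fun b : Tor (fine n M) × Fin (d + 1) => blockOf n M b.1) ι)).κ * ((BlockNorm.ofBlocks (unitTorusGeo L k M) (liftBlk (blockOf n M) ι)).κ * CG * ((n : ℝ) * ((d + 1 : ℕ) * ρ) * Real.exp δ) * c) * (CD + PD) * c * Real.exp (-((δ - 2 * s) * tdistT M y y'))) := by
    rw [Matrix.mulVecLin_mul, Matrix.mulVecLin_mul]
    exact hasMaj_comp_exp (ρ := δ - 2 * s) htri hd hrow (by rw [hκS]; positivity) (by positivity) (by linarith) (by linarith) (by linarith) hin hDT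
  set A : ℝ := CG + CG * ((n : ℝ) * ((d + 1 : ℕ) * ρ) * Real.exp δ) * (CD + PD) * c * c with hAdef
  have hA0 : 0 ≤ A := by positivity
  have hS0 : HasMaj (BlockNorm.ofBlocks (unitTorusGeo L k M) (liftBlk (blockOf n M) ι)) (BlockNorm.ofBlocks (unitTorusGeo L k M) (liftBlk (blockOf n M) ι)) (Matrix.mulVecLin (cGreen M n (fun _ _ => (1 : Matrix ι ι ℝ)) a - cGreen M n (fun _ _ => (1 : Matrix ι ι ℝ)) a * (cgrad M n T - cgrad M n fun _ _ => 1)ᵀ * (cgrad M n T * cGreen M n T a)))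
      (fun y y' => A * Real.exp (-((δ - 2 * s) * tdistT M y y'))) := by
    rw [mulVecLin_sub']
    have hG1' := hG1.of_rate_le hd hCG (by linarith : δ - 2 * s ≤ δ)
    refine (hG1'.sub hterm2).mono fun y y' => le_of_eq ?_
    rw [hκS, hκV, hAdef]
    ring
  -- the fixed point and the a-priori bound
  have hfix : Matrix.mulVecLin (cGreen M n T a) =
      Matrix.mulVecLin (cGreen M n (fun _ _ => (1 : Matrix ι ι ℝ)) a - cGreen M n (fun _ _ => (1 : Matrix ι ι ℝ)) a * (cgrad M n T - cgrad M n fun _ _ => 1)ᵀ * (cgrad M n T * cGreen M n T a)) +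
        Matrix.mulVecLin (-(cGreen M n (fun _ _ => (1 : Matrix ι ι ℝ)) a * ((cgrad M n fun _ _ => (1 : Matrix ι ι ℝ))ᵀ * (cgrad M n T - cgrad M n fun _ _ => 1) +
          a • ((csavg M n T - csavg M n fun _ _ => 1)ᵀ * csavg M n T) + a • ((csavg M n fun _ _ => (1 : Matrix ι ι ℝ))ᵀ * (csavg M n T - csavg M n fun _ _ => 1))))) ∘ₗ
          Matrix.mulVecLin (cGreen M n T a) := by
    rw [← Matrix.mulVecLin_mul, ← Matrix.mulVecLin_add]
    exact congrArg Matrix.mulVecLin (cGreen_fixedPoint M n hT h1unit ha)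
  obtain ⟨M₀, hM₀, hap⟩ := exists_const_hasMaj_ofBlocks (g := unitTorusGeo L k M) (liftBlk (blockOf n M) ι) (liftBlk (blockOf n M) ι) (Matrix.mulVecLin (cGreen M n T a))
  have hq' : (BlockNorm.ofBlocks (unitTorusGeo L k M) (liftBlk (blockOf n M) ι)).κ * θK * c < 1 := by rw [hκS, one_mul]; exact hq
  have key := neumann_majorant (b₁ := (BlockNorm.ofBlocks (unitTorusGeo L k M) (liftBlk (blockOf n M) ι))) (b₂ := (BlockNorm.ofBlocks (unitTorusGeo L k M) (liftBlk (blockOf n M) ι))) (ρ := δ - 2 * s) htri hd hrow hθK0 hA0 hM₀ (by linarith) (by linarith) hK hS0 hfix hap hq'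
  refine key.mono fun y y' => le_of_eq ?_
  rw [hκS, one_mul]

end Green

end Summit.QuantumFields.YangMills.BalabanUVNodes.N15.CovLandau

end
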